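import Summits.Langlands.Langlands.Theorems.PhantomRMYoshidaSerreKWAutomorphicGL2
import Literature.NumberTheory.Automorphic.NewformAdelisationAutomorphicForm
import HarnessLib

/-!
# The `L`-normalised newform dictionary in every weight `k ≥ 1`, along an embedding of the
# coefficient field (support of item stmt-Langlands-18743 `DyadicOddResidue.OddPrimesRegularFM`)

For a newform `f ∈ S_k(Γ₁(N))` (any weight; `k ≥ 1` automatically since `f ≠ 0`), a ring
embedding `τ : K_f →+* ℂ` of its coefficient field and a compactness witness `hcpt`, there is an
`L`-ALGEBRAIC cuspidal automorphic datum `π` on `GL₂(𝔸_ℚ)` whose Satake parameter at almost every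
finite place `v = q` is `{β₁⁻¹, β₂⁻¹}`, `β_{1,2}` the complex roots of the `τ`-conjugate Hecke
polynomial `τ(X² - a_q(f) X + ε_f(q) q^{k-1})`
(`exists_isLAlgebraic_hasSatakeParamAt_rootsInv_of_isNewform1`).  This is the pipeline of the
line `adelic-newform-datum-double-twist` of crux `PhantomRMYoshida.SerreKWAutomorphicGL2`
(conjugate newform `g = f^τ`, adelic lift `φ_g ∈ 𝒜₀`, archimedean parameter `{(k-1)/2, (1-k)/2}`,
unitary Satake pair, double twist `⊗ (ε_g⁻¹ ∘ det) ⊗ |det|^{(k-1)/2}`), whose Stub 7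
(`stub_dictionaryL`) is re-proved here under `1 ≤ k` instead of `2 ≤ k` — its proof never used
more (`dictionaryL_of_one_le`); weight one is needed because the printed Fontaine–Mazur theorems
conclude with "a cuspidal eigenform" of unspecified weight.

References: Gelbart 1975, §3 Lemma 3.7, Prop. 3.1, Thm. 5.19; Bump 1997, Thm. 3.6.1;
Buzzard–Gee 2014, Def. 3.1.1, §3.4; Arthur–Clozel 1989, Ch. 3, proof of Thm. 3.1;
Diamond–Shurman 2005, Thm. 6.5.4.
-/

noncomputable section

open scoped MatrixGroups Classical Polynomial
open NumberField IsDedekindDomain Filter Polynomial CongruenceSubgroup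
open Literature.NumberTheory.Automorphic Literature.NumberTheory.EllipticCurves.ModularForms
  Literature.NumberTheory.GaloisRepresentations
open Summit.Langlands.Langlands.Cruxes.SerreKWAutomorphicGL2.AdelicNewformDatumDoubleTwist

namespace Summit.Langlands.Langlands.Theorems

set_option linter.dupNamespace false -- project-wide option; `Summit.Langlands.Langlands` is the mandated namespace

open Rat.HeightOneSpectrum

/-! ## Bookkeeping lemmas for the double twist (as in Stub 7 of the line) -/

/-- `q^{-m/2} = ((√q)^m)⁻¹` as complex numbers, for natural `q, m`. [folklore] -/
private theorem natCast_cpow_neg_half (q m : ℕ) :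
    (q : ℂ) ^ (-(((m : ℝ) / 2 : ℝ) : ℂ)) = ((((Real.sqrt q : ℝ) : ℂ)) ^ m)⁻¹ := by
  have hq : (0 : ℝ) ≤ q := Nat.cast_nonneg q
  rw [Complex.cpow_neg, ← Complex.ofReal_natCast, ← Complex.ofReal_cpow hq,
    show ((m : ℝ) / 2 : ℝ) = (1 / 2) * m by ring, Real.rpow_mul hq, ← Real.sqrt_eq_rpow,
    Real.rpow_natCast, Complex.ofReal_pow]

/-- The Hecke polynomial `X² - a X + e q^{m}` factors as `(X - B x)(X - B y)` with `B = (√q)^m`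
when `x + y = a B⁻¹`, `xy = e` (Vieta). [folklore] -/
private theorem heckePolynomial_eq_prod_of_pair {q m : ℕ} {a e x y : ℂ}
    (hB : (((Real.sqrt q : ℝ) : ℂ)) ≠ 0)
    (hxy : x + y = a * ((((Real.sqrt q : ℝ) : ℂ)) ^ m)⁻¹) (hxy' : x * y = e) :
    (X ^ 2 - C a * X + C (e * (q : ℂ) ^ m) : ℂ[X]) =
      (({(((Real.sqrt q : ℝ) : ℂ)) ^ m * x, (((Real.sqrt q : ℝ) : ℂ)) ^ m * y} : Multiset ℂ).map
        fun t => X - C t).prod := by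
  set B : ℂ := (((Real.sqrt q : ℝ) : ℂ)) ^ m with hBdef
  have hBm : B ≠ 0 := pow_ne_zero _ hB
  have hsq : (((Real.sqrt q : ℝ) : ℂ)) ^ 2 = (q : ℂ) := by
    rw [← Complex.ofReal_pow, Real.sq_sqrt (Nat.cast_nonneg q), Complex.ofReal_natCast]
  have hB2 : B * B = (q : ℂ) ^ m := by
    rw [hBdef, ← pow_add, ← two_mul, pow_mul, hsq]
  have h1 : B * x + B * y = a := by
    rw [← mul_add, hxy, mul_left_comm, mul_inv_cancel₀ hBm, mul_one]
  have h2 : B * x * (B * y) = e * (q : ℂ) ^ m := by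
    rw [← hB2, ← hxy']; ring
  simp only [Multiset.insert_eq_cons, Multiset.map_cons, Multiset.map_singleton,
    Multiset.prod_cons, Multiset.prod_singleton]
  rw [← h1, ← h2]
  simp only [map_add, map_mul]
  ring

/-- The inverted roots: `{B⁻¹ e⁻¹ x, B⁻¹ e⁻¹ y} = {(B x)⁻¹, (B y)⁻¹}` when `xy = e ≠ 0`.
[folklore] -/
private theorem map_inv_pair_eq {B e x y : ℂ} (hB : B ≠ 0) (hx : x ≠ 0) (hy : y ≠ 0)
    (hxy' : x * y = e) :
    Multiset.map ((fun t => B⁻¹ * t) ∘ (fun t => e⁻¹ * t)) ({x, y} : Multiset ℂ) =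
      Multiset.map (·⁻¹) ({B * x, B * y} : Multiset ℂ) := by
  have e1 : B⁻¹ * (e⁻¹ * x) = (B * y)⁻¹ := by rw [← hxy']; field_simp
  have e2 : B⁻¹ * (e⁻¹ * y) = (B * x)⁻¹ := by rw [← hxy']; field_simp
  simp only [Function.comp_def, Multiset.insert_eq_cons, Multiset.map_cons, Multiset.map_singleton,
    e1, e2]
  exact Multiset.pair_comm _ _

/-! ## Stub 7 of the line in every weight `k ≥ 1` -/

/-- **The `L`-normalised dictionary in weight `k ≥ 1`** (Stub 7 `stub_dictionaryL` of the line
`adelic-newform-datum-double-twist`, whose proof used only `1 ≤ k`).  Let `f ∈ S_k(Γ₁(N))`,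
`k ≥ 1`, be a newform and `π = W / W'` a cuspidal datum on `GL₂(𝔸_ℚ)` with `φ_f ∈ W ∖ W'` and
archimedean parameter `{(k-1)/2, (1-k)/2}`.  Then there is an `L`-algebraic cuspidal datum `π₂`
whose Satake parameter at almost every finite place `v = q` is `{β₁⁻¹, β₂⁻¹}`, `β_{1,2}` the
complex roots of the Hecke polynomial `X² - a_q X + ε(q) q^{k-1}`: unitary Satake pair `{x, y}`,
`x + y = a_q (√q)^{1-k}`, `xy = ε(q)` at `v ∤ N` (`hasSatakeParamAt_pair_of_adelicLiftFunA_mem`),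
then the finite-order twist by `ofDirichlet ε⁻¹ ∘ det` (pair `{y⁻¹, x⁻¹}`, same archimedean
parameter) and the norm twist `|det|^{(k-1)/2}` (pair `q^{-(k-1)/2}{y⁻¹, x⁻¹} = {β_j⁻¹}`, infinity
type `{(k-1, 0), (0, k-1)}`, `L`-algebraic).
[cite: Gelbart1975, §3 Lemma 3.7 and Thm. 5.19] [cite: Bump1997, Thm. 3.6.1, pp. 340–342]
[cite: BuzzardGeeLMS2014, Def. 3.1.1 and §3.4] [cite: ArthurClozelAMS120, Ch. 3, proof of Thm. 3.1 (p. 172)] -/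
theorem dictionaryL_of_one_le
    (N : ℕ) [NeZero N] (k : ℤ) (hk : 1 ≤ k) (f : CuspForm (Gamma1 N) k) (hf : IsNewform1 f)
    (hcpt : isCompact_glFiniteIntegralLevel 2 ℚ) (π : CuspidalAutomorphicRepData 2 ℚ hcpt)
    (hW : adelicLiftFunA N k ⇑f ∈ π.1.W) (hW' : adelicLiftFunA N k ⇑f ∉ π.1.W')
    (harch : π.1.HasArchParameter (fun _ => ({((k : ℂ) - 1) / 2, (1 - (k : ℂ)) / 2} : Multiset ℂ))) :
    ∃ π₂ : CuspidalAutomorphicRepData 2 ℚ hcpt, π₂.1.IsLAlgebraic ∧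
      ∀ᶠ v : HeightOneSpectrum (𝓞 ℚ) in Filter.cofinite,
        π₂.1.HasSatakeParamAt v
          (((heckePolynomial f ((Rat.HeightOneSpectrum.primesEquiv v : Nat.Primes) : ℕ)).map
              (algebraMap (coeffCharField f) ℂ)).roots.map (·⁻¹)) := by
  obtain ⟨m, hm⟩ : ∃ m : ℕ, k - 1 = m := ⟨(k - 1).toNat, (Int.toNat_of_nonneg (by omega)).symm⟩
  -- (ii) the finite-order twist by `ε⁻¹ ∘ det`
  set ε : DirichletCharacter ℂ N := nebentypus f
  set χ₁ : HeckeCharacter ℚ := HeckeCharacter.ofDirichlet ε⁻¹ with hχ₁def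
  have hχ₁ : χ₁.IsFiniteOrder := HeckeCharacter.isFiniteOrder_ofDirichlet ε⁻¹
  set π₁ : CuspidalAutomorphicRepData 2 ℚ hcpt := π.twist χ₁ hχ₁
  have harch₁ :
      π₁.1.HasArchParameter (fun _ => ({((k : ℂ) - 1) / 2, (1 - (k : ℂ)) / 2} : Multiset ℂ)) :=
    AutomorphicRepData.HasArchParameter.twist π.1 χ₁ hχ₁ harch
  -- (iii) the norm twist `|det|^{(k-1)/2}` and the infinity type
  obtain ⟨T, hTwf, hTa, hTL⟩ := exists_infinityType_halfTwist_isLAlgebraic k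
  have hT₁ : π₁.1.HasInfinityType T := ⟨hTwf, hTa ▸ harch₁⟩
  obtain ⟨χ, π₂, hχ, hW₂, hW₂', hT₂⟩ :=
    CuspidalAutomorphicRepData.exists_twist_hasInfinityType π₁ (((k : ℝ) - 1) / 2) hT₁
  refine ⟨π₂, ⟨_, hT₂, hTL⟩, ?_⟩
  -- (iv)–(vi) the Satake parameters at almost every `v`
  have h1 := AutomorphicRepData.eventually_hasSatakeParamAt_twist π.1 hχ₁
  have h2 : ∀ᶠ v : HeightOneSpectrum (𝓞 ℚ) in cofinite,
      ¬ v.asIdeal ∣ Ideal.span {(N : 𝓞 ℚ)} := by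
    rw [eventually_cofinite]
    simpa only [not_not] using Ideal.finite_factors (Rat.span_natCast_ne_zero N)
  filter_upwards [h1, h2] with v hv₁ hv
  have hq : ((Rat.HeightOneSpectrum.primesEquiv v : Nat.Primes) : ℕ) = natGenerator v := rfl
  rw [hq]
  have hqp : (natGenerator v).Prime := prime_natGenerator v
  haveI : NeZero (natGenerator v) := ⟨hqp.ne_zero⟩
  have hqN : ¬ natGenerator v ∣ N := fun h => hv ((Rat.natGenerator_dvd_iff v N).1 h)
  have hs0 : ((Real.sqrt (natGenerator v) : ℝ) : ℂ) ≠ 0 := by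
    exact_mod_cast (Real.sqrt_pos.2 (Nat.cast_pos.2 hqp.pos)).ne'
  -- (i) the eigenvalues of the newform and the unitary pair
  have hT : heckeT (Gamma1 N) k (natGenerator v) f =
      (UpperHalfPlane.qExpansion 1 ⇑f).coeff (natGenerator v) • f := by
    rw [← IsNewform1.heckeEigenvalue_eq_coeff_holds hf hqp]
    exact heckeT_eq_heckeEigenvalue_smul f (natGenerator v) (hf.2.1 _ hqp)
  have hD : diamondOp N k ((natGenerator v : ℕ) : ZMod N) f = ε (natGenerator v : ZMod N) • f :=
    hf.diamondOp_natCast_apply_of_not_dvd hqp hqN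
  have he : ε (natGenerator v : ZMod N) ≠ 0 :=
    ((ZMod.isUnit_prime_of_not_dvd hqp hqN).map ε).ne_zero
  obtain ⟨x, y, hxy, hxy'⟩ := exists_pair_add_eq_mul_eq
    ((UpperHalfPlane.qExpansion 1 ⇑f).coeff (natGenerator v) *
      ((((Real.sqrt (natGenerator v) : ℝ) : ℂ)) ^ m)⁻¹) (ε (natGenerator v : ZMod N))
  have hx : x ≠ 0 := fun h => he (by rw [← hxy', h, zero_mul])
  have hy : y ≠ 0 := fun h => he (by rw [← hxy', h, mul_zero])
  have hsat : π.1.HasSatakeParamAt v ({x, y} : Multiset ℂ) :=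
    hasSatakeParamAt_pair_of_adelicLiftFunA_mem π.1 f hW hW' hv hT hD
      (by rw [hm, zpow_natCast]; exact hxy) hxy'
  -- (ii) + (iv): the Satake parameters of the two twists
  have hsat₂ :=
    AutomorphicRepData.HasSatakeParamAt.of_map_mulChar_detTwist_of_cpow hχ hW₂ hW₂' (hv₁ _ hsat)
  -- (v) the multiset identity
  have hc₁ : χ₁.valueAtUniformizer v = (ε (natGenerator v : ZMod N))⁻¹ := by
    rw [hχ₁def, HeckeCharacter.valueAtUniformizer_ofDirichlet ε⁻¹ hqN,
      Literature.NumberTheory.GaloisRepresentations.Rat.residueCard_eq_natGenerator,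
      MulChar.inv_apply_eq_inv']
  have hc₂ : (v.residueCard : ℂ) ^ (-(((((k : ℝ) - 1) / 2 : ℝ)) : ℂ)) =
      ((((Real.sqrt (natGenerator v) : ℝ) : ℂ)) ^ m)⁻¹ := by
    have hkm : ((k : ℝ) - 1) = (m : ℝ) := by exact_mod_cast hm
    rw [Literature.NumberTheory.GaloisRepresentations.Rat.residueCard_eq_natGenerator, hkm]
    exact natCast_cpow_neg_half _ _
  rw [hc₁, hc₂, Multiset.map_map, map_inv_pair_eq (pow_ne_zero _ hs0) hx hy hxy'] at hsat₂
  rw [map_heckePolynomial, hm, zpow_natCast, heckePolynomial_eq_prod_of_pair hs0 hxy hxy',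
    Polynomial.roots_multiset_prod_X_sub_C]
  exact hsat₂

/-! ## The dictionary along an embedding of the coefficient field -/

/-- A newform has weight `k ≥ 1`: cusp forms of weight `k ≤ 0` vanish
(`cuspForm_eq_zero_of_weight_nonpos`) while a newform is normalised (`a₁ = 1`). [folklore] -/
theorem IsNewform1.one_le_weight {N : ℕ} [NeZero N] {k : ℤ} {f : CuspForm (Gamma1 N) k}
    (hf : IsNewform1 f) : 1 ≤ k := by
  by_contra hk
  exact IsNormalized.ne_zero hf.2.2.2 (cuspForm_eq_zero_of_weight_nonpos (by omega) f)

/-- **Newform ⟹ `L`-algebraic cuspidal `π` on `GL₂(𝔸_ℚ)` with Satake parameters the inverted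
roots of the conjugate Hecke polynomials, along any embedding `τ : K_f → ℂ`.**  For a newform
`f ∈ S_k(Γ₁(N))` (any weight), `τ : K_f →+* ℂ` and `hcpt` there is an `L`-algebraic cuspidal
datum `π` on `GL₂(𝔸_ℚ)` such that for almost every finite place `v = q`, `π` has Satake
parameter `{β₁⁻¹, β₂⁻¹}` where `τ(X² - a_q(f) X + ε_f(q) q^{k-1}) = (X - β₁)(X - β₂)` in `ℂ[X]`.
Proof: the conjugate newform `g` of `f` along `τ` (`stub_conjugateNewform`: `H_q(g) = τ(H_q(f))`
for `q ∤ N M`), its adelic lift `φ_g ∈ 𝒜₀(GL₂)` (`adelicLiftFunA_mem_cuspFormsGL`), non-zero,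
killed by the lowering operator (`stub_loweringKillsLift`), the datum it generates has
archimedean parameter `{(k-1)/2, (1-k)/2}` (`stub_archParameterOfGeneratedDatum`), and the
weight-`k ≥ 1` dictionary `dictionaryL_of_one_le`.
[cite: Gelbart1975, §3 Lemma 3.7, Prop. 3.1 and Thm. 5.19] [cite: DiamondShurman2005, Thm. 6.5.4]
[cite: BuzzardGeeLMS2014, Def. 3.1.1 and §3.4] -/
theorem exists_isLAlgebraic_hasSatakeParamAt_rootsInv_of_isNewform1
    {N : ℕ} [NeZero N] {k : ℤ} {f : CuspForm (Gamma1 N) k} (hf : IsNewform1 f)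
    (τ : coeffCharField f →+* ℂ) (hcpt : isCompact_glFiniteIntegralLevel 2 ℚ) :
    ∃ π : CuspidalAutomorphicRepData 2 ℚ hcpt, π.1.IsLAlgebraic ∧
      ∀ᶠ v : HeightOneSpectrum (𝓞 ℚ) in Filter.cofinite,
        π.1.HasSatakeParamAt v
          (((heckePolynomial f ((Rat.HeightOneSpectrum.primesEquiv v : Nat.Primes) : ℕ)).map
              τ).roots.map (·⁻¹)) := by
  have hk : 1 ≤ k := IsNewform1.one_le_weight hf
  obtain ⟨M, _instM, g, hg, hconj⟩ := stub_conjugateNewform N k f hf τ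
  obtain ⟨hsm, hlow⟩ := stub_loweringKillsLift M k g hcpt
  have hφ : adelicLiftFunA M k ⇑g ∈ cuspFormsGL 2 ℚ hcpt :=
    Literature.NumberTheory.Automorphic.adelicLiftFunA_mem_cuspFormsGL g hcpt
  have hφ0 : adelicLiftFunA M k ⇑g ≠ 0 := adelicLiftFunA_ne_zero_of_isNewform1 hg
  have harch := stub_archParameterOfGeneratedDatum M k g hcpt hlow hφ hφ0
  obtain ⟨π₂, hL, hsat₂⟩ :=
    dictionaryL_of_one_le M k hk g hg hcpt (CuspidalAutomorphicRepData.ofCuspForm hφ hφ0)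
      (CuspidalAutomorphicRepData.mem_W_ofCuspForm hφ hφ0)
      (CuspidalAutomorphicRepData.not_mem_W'_ofCuspForm hφ hφ0) harch
  refine ⟨π₂, hL, ?_⟩
  have hgoodNM := eventually_not_dvd (n := N * M) (mul_ne_zero (NeZero.ne N) (NeZero.ne M))
  filter_upwards [hsat₂, hgoodNM] with v hv hvNM
  rwa [hconj _ (Rat.HeightOneSpectrum.primesEquiv v).2 hvNM] at hv

end Summit.Langlands.Langlands.Theorems

end
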